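import Summits.RiemannHypothesis.RiemannHypothesis.Theorems.SemilocalDeletionDipoleHalfRoom
import Summits.RiemannHypothesis.RiemannHypothesis.Theorems.HandoffLadderTheoremRungs
import HarnessLib

/-!
# The half-room law, UNCONDITIONAL instances: the `{∞}` form past `(log 2)/2` and the `{∞, 2}` form past `(log 3)/2`

Sequel to `SemilocalDeletionDipoleHalfRoom.lean` (§4: at a wall of consecutive primes `q < q'`, under the rung
`WeilPositivityOn((log q)/2 + δ)`, `λ_min(S_q; (log q)/2 + δ; σ) ∈ [−log q/√q, −log q/√q + 2·ε_σ̄(δ)]`).  The tree PROVES the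
rungs `weilPositivityOn_log_three_half` (`(log 3)/2`) and `weilPositivityOn_log5half` (`(log 5)/2`), so for the first two
walls the sandwich is unconditional: `S_2 = ∅` (the archimedean form alone) on `((log 2)/2, (log 3)/2]` and `S_3 = {2}`
(Connes–Consani's semi-local case `{∞, 2}`) on `((log 3)/2, (log 5)/2]`, in both free sectors.  Certified numerics of the cell
(cc-s2-1 gen10, kit j197912, lineage E, N = 200; HOME/cc-s2-1/gen10/HALFROOM-CHECK.md): at `(log 5)/2` the `{2}`-form's free-odd
section bottom is `−0.61649`, inside the proved `[−0.63428, −0.63428 + 2ε_ev(0.2554)] ⊆ [−0.63428, −0.57590]`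
(`ε_ev,200(0.2554) = 0.02919`); at `(log 3)/2` the `∅`-form's free-odd bottom `−0.43029 ∈ [−0.49013, −0.30945]`.
Nothing here bears on RH.
-/

set_option linter.dupNamespace false

noncomputable section

open Complex Filter Set MeasureTheory
open scoped Real Topology ComplexConjugate

namespace Summit.RiemannHypothesis.RiemannHypothesis.Theorems.SemilocalDeletionDipoleHalfRoom

open Literature.NumberTheory.LFunctions
open Summit.RiemannHypothesis.RiemannHypothesis.Theorems.HandoffSemilocalEnergy
open Summit.RiemannHypothesis.RiemannHypothesis.Theorems.SemilocalDeletionDipole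
open Summit.RiemannHypothesis.RiemannHypothesis.Theorems.Handoff

variable {δ : ℝ}

/-! ## Unconditional instances from the tree's rungs -/

/-- `log 5 < 2 log 3`, i.e. `(log 5)/2 − (log 3)/2 < (log 3)/2`. -/
theorem log_five_lt_two_mul_log_three : Real.log 5 < 2 * Real.log 3 := by
  rw [← Real.log_rpow (by norm_num)]
  exact Real.log_lt_log (by norm_num) (by norm_num)

/-- `log 3 < 2 log 2`. -/
theorem log_three_lt_two_mul_log_two : Real.log 3 < 2 * Real.log 2 := by
  rw [← Real.log_rpow (by norm_num)]
  exact Real.log_lt_log (by norm_num) (by norm_num)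

/-- **UNCONDITIONAL, `S = {∞, 2}` (Connes–Consani's first semi-local case), odd sector.** For `0 < δ` with
`(log 3)/2 + δ ≤ (log 5)/2` (the rung `weilPositivityOn_log5half`):
`λ_min({2}; (log 3)/2 + δ; odd) ∈ [−log 3/√3, −log 3/√3 + 2·ε_ev(δ)]`. -/
theorem semilocalGroundEnergy_two_odd_mem_Icc (hδ0 : 0 < δ) (hδ5 : Real.log 3 / 2 + δ ≤ Real.log 5 / 2) :
    semilocalGroundEnergy {2} (fun g ↦ ∀ t, g (-t) = -g t) (Real.log 3 / 2 + δ) ∈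
      Icc (-(Real.log 3 / Real.sqrt 3)) (-(Real.log 3 / Real.sqrt 3) + 2 * weilEvenGroundEnergy δ) := by
  have hδ : 2 * δ < Real.log 3 := by linarith [log_five_lt_two_mul_log_three]
  have hpos : WeilPositivityOn (Real.log 3 / 2 + δ) := EvenWinsBeyondArch.weilPositivityOn_log5half.mono hδ5
  have h := semilocalGroundEnergy_primesBelow_odd_mem_Icc HandoffLadderTheoremRungs.consecutivePrimes_three_five hδ0 (by exact_mod_cast hδ5) (by exact_mod_cast hδ)
    (by exact_mod_cast hpos)
  rw [show Nat.primesBelow 3 = {2} from by decide] at h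
  exact_mod_cast h

/-- **UNCONDITIONAL, `S = {∞, 2}`, even sector**: `λ_min({2}; (log 3)/2 + δ; even) ∈ [−log 3/√3, −log 3/√3 + 2·ε_od(δ)]`
for `0 < δ`, `(log 3)/2 + δ ≤ (log 5)/2`. -/
theorem semilocalGroundEnergy_two_even_mem_Icc (hδ0 : 0 < δ) (hδ5 : Real.log 3 / 2 + δ ≤ Real.log 5 / 2) :
    semilocalGroundEnergy {2} (fun g ↦ ∀ t, g (-t) = g t) (Real.log 3 / 2 + δ) ∈
      Icc (-(Real.log 3 / Real.sqrt 3)) (-(Real.log 3 / Real.sqrt 3) + 2 * weilOddGroundEnergy δ) := by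
  have hδ : 2 * δ < Real.log 3 := by linarith [log_five_lt_two_mul_log_three]
  have hpos : WeilPositivityOn (Real.log 3 / 2 + δ) := EvenWinsBeyondArch.weilPositivityOn_log5half.mono hδ5
  have h := semilocalGroundEnergy_primesBelow_even_mem_Icc HandoffLadderTheoremRungs.consecutivePrimes_three_five hδ0 (by exact_mod_cast hδ5) (by exact_mod_cast hδ)
    (by exact_mod_cast hpos)
  rw [show Nat.primesBelow 3 = {2} from by decide] at h
  exact_mod_cast h

/-- **UNCONDITIONAL, `S = {∞}` (no prime), odd sector.** For `0 < δ` with `(log 2)/2 + δ ≤ (log 3)/2`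
(the rung `weilPositivityOn_log_three_half`): `λ_min(∅; (log 2)/2 + δ; odd) ∈ [−log 2/√2, −log 2/√2 + 2·ε_ev(δ)]`. -/
theorem semilocalGroundEnergy_empty_odd_mem_Icc (hδ0 : 0 < δ) (hδ3 : Real.log 2 / 2 + δ ≤ Real.log 3 / 2) :
    semilocalGroundEnergy ∅ (fun g ↦ ∀ t, g (-t) = -g t) (Real.log 2 / 2 + δ) ∈
      Icc (-(Real.log 2 / Real.sqrt 2)) (-(Real.log 2 / Real.sqrt 2) + 2 * weilEvenGroundEnergy δ) := by
  have hδ : 2 * δ < Real.log 2 := by linarith [log_three_lt_two_mul_log_two]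
  have hpos : WeilPositivityOn (Real.log 2 / 2 + δ) := weilPositivityOn_log_three_half.mono hδ3
  have h := semilocalGroundEnergy_primesBelow_odd_mem_Icc HandoffLadderTheoremRungs.consecutivePrimes_two_three hδ0 (by exact_mod_cast hδ3) (by exact_mod_cast hδ)
    (by exact_mod_cast hpos)
  rw [show Nat.primesBelow 2 = ∅ from by decide] at h
  exact_mod_cast h

/-- **UNCONDITIONAL, `S = {∞}`, even sector**: `λ_min(∅; (log 2)/2 + δ; even) ∈ [−log 2/√2, −log 2/√2 + 2·ε_od(δ)]`
for `0 < δ`, `(log 2)/2 + δ ≤ (log 3)/2`. -/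
theorem semilocalGroundEnergy_empty_even_mem_Icc (hδ0 : 0 < δ) (hδ3 : Real.log 2 / 2 + δ ≤ Real.log 3 / 2) :
    semilocalGroundEnergy ∅ (fun g ↦ ∀ t, g (-t) = g t) (Real.log 2 / 2 + δ) ∈
      Icc (-(Real.log 2 / Real.sqrt 2)) (-(Real.log 2 / Real.sqrt 2) + 2 * weilOddGroundEnergy δ) := by
  have hδ : 2 * δ < Real.log 2 := by linarith [log_three_lt_two_mul_log_two]
  have hpos : WeilPositivityOn (Real.log 2 / 2 + δ) := weilPositivityOn_log_three_half.mono hδ3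
  have h := semilocalGroundEnergy_primesBelow_even_mem_Icc HandoffLadderTheoremRungs.consecutivePrimes_two_three hδ0 (by exact_mod_cast hδ3) (by exact_mod_cast hδ)
    (by exact_mod_cast hpos)
  rw [show Nat.primesBelow 2 = ∅ from by decide] at h
  exact_mod_cast h


/-! ## The LOAD FLOOR: `r(q) ≥ 1 − 2ε(δ_q)/cap(q)` under `H(q)`, `δ_q` = half the log-gap to the next prime -/

variable {q q' : ℕ}


/-- **THE LOAD FLOOR.** For consecutive primes `q < q'` satisfying the handoff step `H(q)` (= Weil positivity on `C((log q')/2)`),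
theory-2's load `r(q) = D_q((log q')/2)/cap(q)` obeys `1 − 2·ε(δ_q)/cap(q) ≤ r(q)`, `δ_q := (log q' − log q)/2` (half the
log-gap), `cap(q) = log q/√q` — the companion of `HandoffLoadCeiling.handoffLoad_le_one_sub_of_handoffH`
(`r(q) ≤ 1 − ε((log q')/2)/cap(q)`).  Since `ε` is non-increasing, the floor RISES with the prime gap: loads can only dip after
SHORT gaps (cell data, two-lineage float: r(7) = 0.966 [gap to 11, δ = 0.226], r(13) = 0.897 [δ = 0.134], r(11) = 0.760 [δ = 0.084]). -/
theorem one_sub_le_handoffLoad_of_handoffH (h : ConsecutivePrimes q q') (H : HandoffH q q') :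
    1 - 2 * weilGroundEnergy ((Real.log q' - Real.log q) / 2) / (Real.log q / Real.sqrt q) ≤ handoffLoad q q' := by
  have hq1 : (1 : ℝ) < q := by exact_mod_cast h.1.one_lt
  have hqq' : (q : ℝ) < q' := by exact_mod_cast h.2.2.1
  have hlogq : 0 < Real.log q := Real.log_pos hq1
  have hcap : 0 < Real.log q / Real.sqrt q := div_pos hlogq (Real.sqrt_pos.2 (by linarith))
  have hgap : Real.log q < Real.log q' := Real.log_lt_log (by linarith) hqq'
  set δ : ℝ := (Real.log q' - Real.log q) / 2 with hδdef
  have hδ0 : 0 < δ := by rw [hδdef]; linarith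
  have hwin : Real.log q / 2 + δ = Real.log q' / 2 := by rw [hδdef]; ring
  have hδ : 2 * δ < Real.log q := by rw [hδdef]; linarith [log_lt_two_mul_log_of_consecutivePrimes h]
  have hpos : WeilPositivityOn (Real.log q / 2 + δ) := by rw [hwin]; exact (handoffH_iff_weilPositivityOn h).1 H
  have hm := aggregateDeficit_mem_Icc h hδ0 hwin.le hδ hpos
  rw [mem_Icc, hwin] at hm
  rw [handoffLoad, le_div_iff₀ hcap, sub_mul, one_mul, div_mul_cancel₀ _ hcap.ne']
  exact hm.1

/-- **UNCONDITIONAL load floor at `q = 2`** (rung `(log 3)/2`): `1 − 2ε((log 3 − log 2)/2)/cap(2) ≤ r(2)`. -/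
theorem one_sub_le_handoffLoad_two :
    1 - 2 * weilGroundEnergy ((Real.log 3 - Real.log 2) / 2) / (Real.log 2 / Real.sqrt 2) ≤ handoffLoad 2 3 := by
  have H : HandoffH 2 3 :=
    (handoffH_iff_weilPositivityOn HandoffLadderTheoremRungs.consecutivePrimes_two_three).2 (by exact_mod_cast weilPositivityOn_log_three_half)
  exact_mod_cast one_sub_le_handoffLoad_of_handoffH HandoffLadderTheoremRungs.consecutivePrimes_two_three H

/-- **UNCONDITIONAL load floor at `q = 3`** (rung `(log 5)/2`): `1 − 2ε((log 5 − log 3)/2)/cap(3) ≤ r(3)`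
(cell data: `ε₂₀₀(0.2554) = 0.0292`, `cap(3) = 0.6343` ⇒ floor `≥ 0.908`; measured `r(3) = 0.6165/0.6343 = 0.972`). -/
theorem one_sub_le_handoffLoad_three :
    1 - 2 * weilGroundEnergy ((Real.log 5 - Real.log 3) / 2) / (Real.log 3 / Real.sqrt 3) ≤ handoffLoad 3 5 := by
  have H : HandoffH 3 5 :=
    (handoffH_iff_weilPositivityOn HandoffLadderTheoremRungs.consecutivePrimes_three_five).2
      (by exact_mod_cast EvenWinsBeyondArch.weilPositivityOn_log5half)
  exact_mod_cast one_sub_le_handoffLoad_of_handoffH HandoffLadderTheoremRungs.consecutivePrimes_three_five H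

end Summit.RiemannHypothesis.RiemannHypothesis.Theorems.SemilocalDeletionDipoleHalfRoom

end
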